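import Summits.BirchSwinnertonDyer.BirchSwinnertonDyer.Theorems.ThetaPartnerAtTwoSignedMainConjectureCMTwoRankZeroPTDeepAdditiveInertia
import Literature.NumberTheory.EllipticCurves.ZpExtensionUnramifiedProofs
import Literature.NumberTheory.EllipticCurves.Kato2004.IwasawaH1ReductionSeparated
import Literature.NumberTheory.EllipticCurves.IsogenyFrobeniusTraceProofs
import Literature.NumberTheory.EllipticCurves.RootNumberTwistProofs
import Literature.NumberTheory.EllipticCurves.ComplexMultiplicationNotSemistable
import HarnessLib

/-!
# Route `ThetaPartnerAtTwo` (TP2), crux K2R0P♭ (stmt-BirchSwinnertonDyer-26471; derived node K2r0P 24945), line `rankzero` v19,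
# stub `stub_poitouTateDeepTwoGen` = (S_PT) — brick **B6c, part 2** of `Cruxes/SignedMainConjectureCMTwoRankZeroOfPub/PT-DEEP-HALF-DESIGN-w2g4.md`
# §2 (d): the uniform additive-place exponent in the `Kato2004.integralH1` currency over `ℚ`, along the
# layers of a `ℤ_p`-extension, and for CM curves

HONEST FRAMING (cell `pub/bsd-wall`, W-ALL row 1; extra width seat `bsd-wall-tp2-p2-w5` g0, `--supports` only).
THEOREMS ONLY (no definition, no named fact, no instance, no `sorry`); closes no item; BSD is NOT proved by
any of this.  Sequel of `…PTDeepAdditiveInertia.lean` (§1–§2 there: a uniform `e > 0` killing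
`H¹(I_𝔓, E[p^k])` for every prime `𝔓` above an additive `v ∤ p` and every `k`).

## What is proved (over `ℚ`)

* §3 `exists_nsmul_resLe_inertia_torsion_eq_zero_of_hasAdditiveReductionAt` — coefficients `E[p^k]`: for
  every `U ≤ Γ_ℚ` CONTAINING `I_𝔓` and every `y ∈ H¹(U, E[p^k])`, `res_{U ⊓ I_𝔓}(e • y) = 0` (the clause of
  `Kato2004.integralH1 (E[p^k]) p U` at `v`, up to `e`);
  `exists_nsmul_resLe_inertia_tate_eq_zero_of_hasAdditiveReductionAt` — coefficients `T_pE` (by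
  `Kato2004.reduceH1Pk_resLe` and the separatedness `Kato2004.eq_zero_of_forall_reduceH1Pk_eq_zero`,
  Rubin App. B Prop. B.2.3);
  `exists_nsmul_mem_integralH1_of_forall_not_additive` — ONE exponent `E = ∏_{v additive} e_v` with
  `E • x ∈ Kato2004.integralH1 (tateRep E p) p U` as soon as `x` is integral at the NON-additive `v ≠ p`
  and `U` contains the inertia groups above the additive ones (finitely many: `finite_badPlaces`);
  `exists_nsmul_mem_integralH1_layerSubgroup_of_forall_not_additive` — the same for `U = κ.layerSubgroup n`,
  EVERY layer `n` of ANY `ℤ_p`-extension `κ` of `ℚ` (`ZpExtension.inertia_le_kerSubgroup`: `I_𝔓 ≤ Gal(ℚ̄/ℚ_∞)`),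
  i.e. UNIFORMLY IN THE LAYER — what the passage to `Kato2004.IwasawaH1Data` / `IsNormCompatible` needs.
* §4 `hasAdditiveReductionAt_of_hasCM_of_not_hasGoodReductionAt` — a CM curve over `ℚ` is additive at every
  bad place (place-indexed; trichotomy + `not_hasMultiplicativeReductionAtPrime_of_hasCM` through the bridge
  `hasMultiplicativeReductionAtPrime_iff_hasMultiplicativeReductionAt_ringOfIntegers`);
  `exists_nsmul_mem_integralH1_layerSubgroup_of_hasCM` — for CM `E/ℚ` only the GOOD `v ≠ p` remain as
  hypotheses (the unramified condition of the Selmer structure): the integrality input at the bad places of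
  the (S_PT) limit (memo §2 (d)–(e)), with the memo's constant `4` replaced by the uniform `E`
  (absorbed by the `∃ m` of (S_PT)).

* §5 THE INTERFACE FORM (I) of the lead's `B9-INTERFACE-g10.md` (`poitouTateDeep_of_levelwise`, hypothesis `hint`):
  `pow_factorization_smul_mem_of_nsmul_mem` (`E • y ∈ S ⇒ p^{v_p E} • y ∈ S` in a `ℤ_p`-module),
  `exists_pow_smul_mem_integralH1_layerSubgroup_of_forall_reduceH1Pk` — a UNIFORM `e` with
  `(p : ℤ_[p]) ^ e • y ∈ integralH1 (tateRep E p) p (κ.layerSubgroup n)` for every `n`, `y`, as soon as every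
  reduction `red_{p^k} y` is unramified at the primes above the non-additive `v ≠ p` (the clause carried by the
  admissible sets `R n k`), and `…_of_hasCM_of_forall_reduceH1Pk` (CM: only the GOOD `v ≠ p`).

The hypothesis `I_𝔓 ≤ U` is necessary (over a ramified extension where good reduction is acquired the
uniform bound fails); nothing is claimed at multiplicative places or at `v ∋ p`.

References: [Kato2004Asterisque] §8.2, Lemma 8.5 (pp. 180–184), §12.2 (p. 220); [Rubin2000] App. B
Prop. B.2.3; [SilvermanATAEC1994] Thm. IV.10.2(a) (PDF pp. 358–359), Thm. II.6.4 (PDF p. 148);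
[SilvermanAEC2009] Prop. VII.5.1; [NeukirchANT1999] II §9 Prop. (9.6).
-/

set_option autoImplicit false
-- the Theorems namespace of this sub repeats the summit name by design (D-0017 nested layout)
set_option linter.dupNamespace false

noncomputable section

open scoped Classical NumberField Pointwise
open CategoryTheory Function Field NumberField IsDedekindDomain IsDedekindDomain.HeightOneSpectrum
open Literature.NumberTheory.EllipticCurves Literature.NumberTheory.GaloisRepresentations
open _root_.TopRep _root_.ContinuousCohomology
open WeierstrassCurve (geomPoints geomTorsion)

namespace Summit.BirchSwinnertonDyer.BirchSwinnertonDyer.Theorems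

namespace SignedLowerOffTwo.PTDeep

/-! ## §3 Over `ℚ`: the `Kato2004.integralH1` currency — restriction to `U ⊓ I_𝔓`, torsion and
`T_p`-adic coefficients, and the packaging `E • x ∈ H¹(ℤ_F[1/p], T_pE)` -/

section Rat

open Literature.NumberTheory.EllipticCurves.Kato2004
  Literature.NumberTheory.EllipticCurves.Kato2004.EulerSystemValues Rat.HeightOneSpectrum

variable (W : WeierstrassCurve ℚ) [W.IsElliptic] (p : ℕ) [Fact p.Prime]

/-- **Torsion coefficients, `integralH1` currency.**  `E/ℚ` elliptic, `p` prime, `v ∤ p` of ADDITIVE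
reduction: there is `e > 0` such that for every prime `𝔓 ∣ v` of `\bar ℤ`, every subgroup `U ≤ Γ_ℚ`
CONTAINING `I_𝔓` (e.g. `U = Gal(ℚ̄/ℚ_n)` for a layer `ℚ_n` of a `ℤ_p`-extension, unramified at `v`),
every `k` and every `y ∈ H¹(U, E[p^k])`, the restriction of `e • y` to `U ⊓ I_𝔓` vanishes — the
clause of `Kato2004.integralH1 (E[p^k]) p U` at `v`, up to the uniform exponent `e`.
(The hypothesis `I_𝔓 ≤ U` is necessary: over a ramified extension where `E` acquires good reduction
the bound fails.) [cite: SilvermanATAEC1994, Thm. IV.10.2(a), additive case (PDF pp. 358–359)]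
[cite: Kato2004Asterisque, §8.2 and Lemma 8.5 (pp. 180–184)] -/
theorem exists_nsmul_resLe_inertia_torsion_eq_zero_of_hasAdditiveReductionAt
    {v : HeightOneSpectrum (𝓞 ℚ)} (hpv : (p : 𝓞 ℚ) ∉ v.asIdeal) (hadd : W.HasAdditiveReductionAt v) :
    ∃ e : ℕ, 0 < e ∧ ∀ 𝔓 ∈ v.primesAbove, ∀ (U : Subgroup (absoluteGaloisGroup ℚ)),
      𝔓.inertia (absoluteGaloisGroup ℚ) ≤ U → ∀ (k : ℕ)
      (y : H1 (W.torsionGaloisModule ((p : ℤ) ^ k)) U),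
      resLe (W.torsionGaloisModule ((p : ℤ) ^ k)).toTopRep
        (inf_le_left : U ⊓ 𝔓.inertia (absoluteGaloisGroup ℚ) ≤ U) 1 (e • y) = 0 := by
  obtain ⟨e, he, h⟩ :=
    exists_nsmul_h1_inertia_torsion_eq_zero_of_hasAdditiveReductionAt W p hpv hadd
  refine ⟨e, he, fun 𝔓 h𝔓 U hU k y ↦ ?_⟩
  rw [map_nsmul]
  exact h 𝔓 h𝔓 _ (inf_eq_right.mpr hU) k _

variable [ContinuousSMul ℤ_[p] (W.tateModule p)]

/-- **`T_p`-adic coefficients, `integralH1` currency.**  Same setting: there is `e > 0` such that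
for every `𝔓 ∣ v`, every `U ≥ I_𝔓` and every `x ∈ H¹(U, T_pE)`, the restriction of `e • x` to
`U ⊓ I_𝔓` vanishes (the clause of `Kato2004.integralH1 (tateRep E p) p U` at the additive place `v`,
up to `e`).  From the torsion version at every level `k` (`reduceH1Pk_resLe`) and the separatedness
`Kato2004.eq_zero_of_forall_reduceH1Pk_eq_zero` (Rubin App. B Prop. B.2.3).
[cite: SilvermanATAEC1994, Thm. IV.10.2(a), additive case (PDF pp. 358–359)]
[cite: Rubin2000, App. B Prop. B.2.3] [cite: Kato2004Asterisque, §8.2 and Lemma 8.5 (pp. 180–184)] -/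
theorem exists_nsmul_resLe_inertia_tate_eq_zero_of_hasAdditiveReductionAt
    {v : HeightOneSpectrum (𝓞 ℚ)} (hpv : (p : 𝓞 ℚ) ∉ v.asIdeal) (hadd : W.HasAdditiveReductionAt v) :
    ∃ e : ℕ, 0 < e ∧ ∀ 𝔓 ∈ v.primesAbove, ∀ (U : Subgroup (absoluteGaloisGroup ℚ)),
      𝔓.inertia (absoluteGaloisGroup ℚ) ≤ U → ∀ (x : H1 (tateRep W p) U),
      resLe (tateRep W p).toTopRep
        (inf_le_left : U ⊓ 𝔓.inertia (absoluteGaloisGroup ℚ) ≤ U) 1 (e • x) = 0 := by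
  obtain ⟨e, he, h⟩ :=
    exists_nsmul_resLe_inertia_torsion_eq_zero_of_hasAdditiveReductionAt W p hpv hadd
  refine ⟨e, he, fun 𝔓 h𝔓 U hU x ↦ ?_⟩
  refine eq_zero_of_forall_reduceH1Pk_eq_zero W p _ _ fun k ↦ ?_
  rw [reduceH1Pk_resLe, map_nsmul]
  exact h 𝔓 h𝔓 U hU k _

/-- **Packaging: a uniform exponent `E` making classes integral at the additive places.**  For
`E/ℚ` elliptic and `p` prime there is `E > 0` (depending on `E`, `p` only) such that: for every
subgroup `U ≤ Γ_ℚ` containing the inertia groups above every additive place `v ∤ p`, and every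
`x ∈ H¹(U, T_pE)` whose restriction to `U ⊓ I_𝔓` vanishes for every prime `𝔓` above every
NON-additive `v ≠ p` (the good places: unramified classes; the multiplicative places: whatever the
consumer proves there — none for a CM curve), the multiple `E • x` lies in Kato's
`H¹(O_F[1/p], T_pE) = Kato2004.integralH1 (tateRep E p) p U`.  `E = ∏_{v additive} e_v` over the
finite set of additive places (`WeierstrassCurve.finite_badPlaces`).
[cite: Kato2004Asterisque, §8.2 and Lemma 8.5 (pp. 180–184)]
[cite: SilvermanATAEC1994, Thm. IV.10.2(a), additive case (PDF pp. 358–359)] -/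
theorem exists_nsmul_mem_integralH1_of_forall_not_additive :
    ∃ E : ℕ, 0 < E ∧ ∀ (U : Subgroup (absoluteGaloisGroup ℚ)),
      (∀ v : HeightOneSpectrum (𝓞 ℚ), (p : 𝓞 ℚ) ∉ v.asIdeal → W.HasAdditiveReductionAt v →
        ∀ 𝔓 ∈ v.primesAbove, 𝔓.inertia (absoluteGaloisGroup ℚ) ≤ U) →
      ∀ x : H1 (tateRep W p) U,
      (∀ v : HeightOneSpectrum (𝓞 ℚ), ((primesEquiv v : Nat.Primes) : ℕ) ≠ p →
        ¬ W.HasAdditiveReductionAt v → ∀ 𝔓 ∈ v.primesAbove,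
        resLe (tateRep W p).toTopRep
          (inf_le_left : U ⊓ 𝔓.inertia (absoluteGaloisGroup ℚ) ≤ U) 1 x = 0) →
      E • x ∈ integralH1 (tateRep W p) p U := by
  have hp : p.Prime := Fact.out
  -- the finite set of additive places
  have hfin : {v : HeightOneSpectrum (𝓞 ℚ) | W.HasAdditiveReductionAt v}.Finite :=
    (W.finite_badPlaces_holds (𝓞 ℚ)).subset fun v hv ↦
      WeierstrassCurve.HasAdditiveReductionAt.not_hasGoodReductionAt hv
  -- one exponent per place (`1` off the additive places prime to `p`)
  have key : ∀ v : HeightOneSpectrum (𝓞 ℚ), ∃ e : ℕ, 0 < e ∧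
      ((p : 𝓞 ℚ) ∉ v.asIdeal → W.HasAdditiveReductionAt v → ∀ 𝔓 ∈ v.primesAbove,
        ∀ (U : Subgroup (absoluteGaloisGroup ℚ)), 𝔓.inertia (absoluteGaloisGroup ℚ) ≤ U →
        ∀ (x : H1 (tateRep W p) U), resLe (tateRep W p).toTopRep
          (inf_le_left : U ⊓ 𝔓.inertia (absoluteGaloisGroup ℚ) ≤ U) 1 (e • x) = 0) := by
    intro v
    by_cases hpv : (p : 𝓞 ℚ) ∈ v.asIdeal
    · exact ⟨1, one_pos, fun h ↦ absurd hpv h⟩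
    by_cases hadd : W.HasAdditiveReductionAt v
    · obtain ⟨e, he, h⟩ :=
        exists_nsmul_resLe_inertia_tate_eq_zero_of_hasAdditiveReductionAt W p hpv hadd
      exact ⟨e, he, fun _ _ ↦ h⟩
    · exact ⟨1, one_pos, fun _ h ↦ absurd h hadd⟩
  choose e he hkey using key
  refine ⟨∏ v ∈ hfin.toFinset, e v, Finset.prod_pos fun v _ ↦ he v, fun U hU x hx ↦ ?_⟩
  rw [mem_integralH1_iff]
  intro v hv 𝔓 h𝔓
  have hpv : (p : 𝓞 ℚ) ∉ v.asIdeal := WeierstrassCurve.natCast_not_mem_asIdeal_of_primesEquiv_ne hp hv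
  by_cases hadd : W.HasAdditiveReductionAt v
  · have hvmem : v ∈ hfin.toFinset := hfin.mem_toFinset.mpr hadd
    obtain ⟨m, hm⟩ : e v ∣ ∏ w ∈ hfin.toFinset, e w := Finset.dvd_prod_of_mem e hvmem
    rw [hm, mul_nsmul, map_nsmul, hkey v hpv hadd 𝔓 h𝔓 U (hU v hpv hadd 𝔓 h𝔓) x, nsmul_zero]
  · rw [map_nsmul, hx v hv hadd 𝔓 h𝔓, nsmul_zero]

/-- **Along a `ℤ_p`-extension.**  For `E/ℚ` elliptic, `p` prime and ANY `ℤ_p`-extension datum `κ`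
of `ℚ` (unramified outside `p`: `ZpExtension.inertia_le_kerSubgroup`), there is `E > 0` such that for
EVERY layer `n` and every `x ∈ H¹(ℚ_n, T_pE) = H1 (tateRep E p) (κ.layerSubgroup n)` whose restriction
to `Gal(ℚ̄/ℚ_n) ⊓ I_𝔓` vanishes at every prime `𝔓` above every non-additive `v ≠ p`, `E • x` is an
integral class `∈ Kato2004.integralH1 (tateRep E p) p (κ.layerSubgroup n)` — the exponent is UNIFORM
IN THE LAYER `n`, which is what the passage to the norm-compatible limit (`Kato2004.IwasawaH1Data`,
`IsNormCompatible`) requires.  [cite: Kato2004Asterisque, §8.2, Lemma 8.5 (pp. 180–184) and §12.2 (p. 220)]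
[cite: SilvermanATAEC1994, Thm. IV.10.2(a), additive case (PDF pp. 358–359)] -/
theorem exists_nsmul_mem_integralH1_layerSubgroup_of_forall_not_additive (κ : ZpExtension ℚ p) :
    ∃ E : ℕ, 0 < E ∧ ∀ (n : ℕ) (x : H1 (tateRep W p) (κ.layerSubgroup n)),
      (∀ v : HeightOneSpectrum (𝓞 ℚ), ((primesEquiv v : Nat.Primes) : ℕ) ≠ p →
        ¬ W.HasAdditiveReductionAt v → ∀ 𝔓 ∈ v.primesAbove,
        resLe (tateRep W p).toTopRep
          (inf_le_left : κ.layerSubgroup n ⊓ 𝔓.inertia (absoluteGaloisGroup ℚ) ≤ κ.layerSubgroup n)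
          1 x = 0) →
      E • x ∈ integralH1 (tateRep W p) p (κ.layerSubgroup n) := by
  obtain ⟨E, hE, h⟩ := exists_nsmul_mem_integralH1_of_forall_not_additive W p
  refine ⟨E, hE, fun n x hx ↦ h (κ.layerSubgroup n) (fun v hpv _ 𝔓 h𝔓 ↦ ?_) x hx⟩
  exact (ZpExtension.inertia_le_kerSubgroup_holds ℚ p κ hpv h𝔓).trans (κ.kerSubgroup_le_layerSubgroup n)

/-! ## §4 CM curves: every bad place is additive, so only the GOOD places `v ≠ p` remain -/

/-- **A CM elliptic curve over `ℚ` has additive reduction at every bad place** (place-indexed form):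
trichotomy (Silverman *AEC* VII.5.1) and «a CM curve has no prime of multiplicative reduction»
(tree: `not_hasMultiplicativeReductionAtPrime_of_hasCM`, Silverman *ATAEC* II.6.4 / proof of II.10.5,
`j(E) ∈ ℤ`), through the bridge `hasMultiplicativeReductionAtPrime_iff_hasMultiplicativeReductionAt_ringOfIntegers`.
[cite: SilvermanATAEC1994, Thm. II.6.4 (PDF p. 148) and proof of Thm. II.10.5 (PDF p. 172)]
[cite: SilvermanAEC2009, Prop. VII.5.1] -/
theorem hasAdditiveReductionAt_of_hasCM_of_not_hasGoodReductionAt (hCM : W.HasCM)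
    {v : HeightOneSpectrum (𝓞 ℚ)} (hv : ¬ W.HasGoodReductionAt v) : W.HasAdditiveReductionAt v := by
  rcases W.hasGoodReductionAt_or_hasMultiplicativeReductionAt_or_hasAdditiveReductionAt v with h | h | h
  · exact absurd h hv
  · haveI := Fact.mk (primesEquiv v).2
    exact absurd ((W.hasMultiplicativeReductionAtPrime_iff_hasMultiplicativeReductionAt_ringOfIntegers v).mpr h)
      (W.not_hasMultiplicativeReductionAtPrime_of_hasCM hCM _)
  · exact h

/-- **CM packaging along a `ℤ_p`-extension.**  For a CM elliptic curve `E/ℚ`, a prime `p` and a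
`ℤ_p`-extension datum `κ` of `ℚ` there is `E > 0` such that for every layer `n` and every
`x ∈ H¹(ℚ_n, T_pE)` whose restriction to `Gal(ℚ̄/ℚ_n) ⊓ I_𝔓` vanishes at every prime `𝔓` above every
GOOD place `v ≠ p` (the unramified condition of a Selmer structure), `E • x ∈ H¹(ℤ_n[1/p], T_pE) =
Kato2004.integralH1 (tateRep E p) p (κ.layerSubgroup n)` — uniformly in `n`.  This is the integrality
input at the bad places of the (S_PT) limit argument for CM curves (PT-DEEP-HALF-DESIGN §2 (d)), with
the constant `4` of the memo replaced by the uniform exponent `E`.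
[cite: Kato2004Asterisque, §8.2, Lemma 8.5 (pp. 180–184) and §12.2 (p. 220)]
[cite: SilvermanATAEC1994, Thm. IV.10.2(a), additive case (PDF pp. 358–359), and Thm. II.6.4] -/
theorem exists_nsmul_mem_integralH1_layerSubgroup_of_hasCM (hCM : W.HasCM) (κ : ZpExtension ℚ p) :
    ∃ E : ℕ, 0 < E ∧ ∀ (n : ℕ) (x : H1 (tateRep W p) (κ.layerSubgroup n)),
      (∀ v : HeightOneSpectrum (𝓞 ℚ), ((primesEquiv v : Nat.Primes) : ℕ) ≠ p →
        W.HasGoodReductionAt v → ∀ 𝔓 ∈ v.primesAbove,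
        resLe (tateRep W p).toTopRep
          (inf_le_left : κ.layerSubgroup n ⊓ 𝔓.inertia (absoluteGaloisGroup ℚ) ≤ κ.layerSubgroup n)
          1 x = 0) →
      E • x ∈ integralH1 (tateRep W p) p (κ.layerSubgroup n) := by
  obtain ⟨E, hE, h⟩ := exists_nsmul_mem_integralH1_layerSubgroup_of_forall_not_additive W p κ
  refine ⟨E, hE, fun n x hx ↦ h n x fun v hv hnadd 𝔓 h𝔓 ↦ hx v hv ?_ 𝔓 h𝔓⟩
  by_contra hgood
  exact hnadd (hasAdditiveReductionAt_of_hasCM_of_not_hasGoodReductionAt W hCM hgood)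

/-! ## §5 The interface form (I) of the (S_PT) assembly (`B9-INTERFACE-g10.md`): `(p : ℤ_[p]) ^ e • y ∈ H¹(ℤ_n[1/p], T_pE)`
from the torsion-level unramified conditions at the GOOD places -/

/-- From an integer multiple to a `p`-power multiple in a `ℤ_p`-module: if `E • y ∈ S` (`E ≠ 0`) for a
`ℤ_p`-submodule `S`, then `p ^ {v_p(E)} • y ∈ S` — the prime-to-`p` part of `E` is a unit of `ℤ_p`
(`PadicInt.norm_int_lt_one_iff_dvd`, `PadicInt.isUnit_iff`). [folklore] -/
theorem pow_factorization_smul_mem_of_nsmul_mem {M : Type*} [AddCommGroup M] [Module ℤ_[p] M]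
    (S : Submodule ℤ_[p] M) {E : ℕ} (hE : E ≠ 0) {y : M} (h : E • y ∈ S) :
    (p : ℤ_[p]) ^ (E.factorization p) • y ∈ S := by
  have hp : p.Prime := Fact.out
  set m : ℕ := E / p ^ E.factorization p with hm
  have hEeq : p ^ E.factorization p * m = E := Nat.ordProj_mul_ordCompl_eq_self E p
  have hcop : p.Coprime m := Nat.coprime_ordCompl hp hE
  -- `m` is a unit of `ℤ_p`
  have hunit : IsUnit ((m : ℤ) : ℤ_[p]) := by
    rw [PadicInt.isUnit_iff]
    refine le_antisymm (PadicInt.norm_le_one _) (not_lt.mp fun hlt ↦ ?_)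
    rw [PadicInt.norm_int_lt_one_iff_dvd] at hlt
    have hdvd : p ∣ m := by exact_mod_cast hlt
    exact (Nat.coprime_primes hp hp).mp (hcop.coprime_dvd_right hdvd) rfl
  obtain ⟨u, hu⟩ := hunit
  have hcast : (E : ℤ_[p]) = (p : ℤ_[p]) ^ E.factorization p * (u : ℤ_[p]) := by
    rw [hu, Int.cast_natCast, ← Nat.cast_pow, ← Nat.cast_mul, hEeq]
  have hE' : (↑u⁻¹ : ℤ_[p]) * (E : ℤ_[p]) = (p : ℤ_[p]) ^ E.factorization p := by
    rw [hcast, mul_comm ((p : ℤ_[p]) ^ E.factorization p), Units.inv_mul_cancel_left]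
  have key : (p : ℤ_[p]) ^ E.factorization p • y = (↑u⁻¹ : ℤ_[p]) • (E • y) := by
    rw [← Nat.cast_smul_eq_nsmul ℤ_[p] E y, smul_smul, hE']
  rw [key]
  exact S.smul_mem _ h

/-- **(I) of `B9-INTERFACE-g10.md`, general form.**  For `E/ℚ` elliptic, `p` prime and a `ℤ_p`-extension
datum `κ` there is a UNIFORM `e : ℕ` such that for every layer `n` and every `y ∈ H¹(ℚ_n, T_pE)`: if at
every torsion level `k` the reduction `red_{p^k} y ∈ H¹(ℚ_n, E[p^k])` restricts to zero on
`Gal(ℚ̄/ℚ_n) ⊓ I_𝔓` for every prime `𝔓` above every NON-additive `v ≠ p` (the unramified-outside-`S`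
clause of the admissible sets `R n k`), then `(p : ℤ_[p]) ^ e • y ∈ Kato2004.integralH1 (tateRep E p) p (κ.layerSubgroup n)`.
(Torsion-level hypotheses ⇒ `T_p`-adic vanishing by `Kato2004.reduceH1Pk_resLe` and the separatedness
`Kato2004.eq_zero_of_forall_reduceH1Pk_eq_zero`; the additive places by §3; `ℕ`-multiple ⇒ `p`-power multiple
by `pow_factorization_smul_mem_of_nsmul_mem`.) [cite: Kato2004Asterisque, §8.2, Lemma 8.5 (pp. 180–184) and §12.2 (p. 220)]
[cite: Rubin2000, App. B Prop. B.2.3] [cite: SilvermanATAEC1994, Thm. IV.10.2(a), additive case (PDF pp. 358–359)] -/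
theorem exists_pow_smul_mem_integralH1_layerSubgroup_of_forall_reduceH1Pk (κ : ZpExtension ℚ p) :
    ∃ e : ℕ, ∀ (n : ℕ) (y : H1 (tateRep W p) (κ.layerSubgroup n)),
      (∀ (k : ℕ) (v : HeightOneSpectrum (𝓞 ℚ)), ((primesEquiv v : Nat.Primes) : ℕ) ≠ p →
        ¬ W.HasAdditiveReductionAt v → ∀ 𝔓 ∈ v.primesAbove,
        resLe (W.torsionGaloisModule ((p : ℤ) ^ k)).toTopRep
          (inf_le_left : κ.layerSubgroup n ⊓ 𝔓.inertia (absoluteGaloisGroup ℚ) ≤ κ.layerSubgroup n) 1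
          (reduceH1Pk W p k (κ.layerSubgroup n) y) = 0) →
      (p : ℤ_[p]) ^ e • y ∈ integralH1 (tateRep W p) p (κ.layerSubgroup n) := by
  obtain ⟨E, hE, h⟩ := exists_nsmul_mem_integralH1_layerSubgroup_of_forall_not_additive W p κ
  refine ⟨E.factorization p, fun n y hy ↦
    pow_factorization_smul_mem_of_nsmul_mem p _ hE.ne' (h n y fun v hv hnadd 𝔓 h𝔓 ↦ ?_)⟩
  refine eq_zero_of_forall_reduceH1Pk_eq_zero W p _ _ fun k ↦ ?_
  rw [reduceH1Pk_resLe]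
  exact hy k v hv hnadd 𝔓 h𝔓

/-- **(I) of `B9-INTERFACE-g10.md` for a CM curve.**  For a CM elliptic curve `E/ℚ`, `p` prime, `κ` a
`ℤ_p`-extension datum: a UNIFORM `e : ℕ` such that for every layer `n` and every `y ∈ H¹(ℚ_n, T_pE)`
whose reductions `red_{p^k} y` are unramified (restriction to `Gal(ℚ̄/ℚ_n) ⊓ I_𝔓` zero) at every prime
`𝔓` above every GOOD `v ≠ p`, for every `k`, one has
`(p : ℤ_[p]) ^ e • y ∈ Kato2004.integralH1 (tateRep E p) p (κ.layerSubgroup n)`.  With (R), (E), (C) this is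
the last displayed hypothesis `hint` of `SignedLowerOffTwo.PTDeep.poitouTateDeep_of_levelwise` for the CM
curves of the crux. [cite: Kato2004Asterisque, §8.2, Lemma 8.5 (pp. 180–184) and §12.2 (p. 220)]
[cite: SilvermanATAEC1994, Thm. IV.10.2(a) (PDF pp. 358–359) and Thm. II.6.4 (PDF p. 148)] -/
theorem exists_pow_smul_mem_integralH1_layerSubgroup_of_hasCM_of_forall_reduceH1Pk (hCM : W.HasCM)
    (κ : ZpExtension ℚ p) :
    ∃ e : ℕ, ∀ (n : ℕ) (y : H1 (tateRep W p) (κ.layerSubgroup n)),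
      (∀ (k : ℕ) (v : HeightOneSpectrum (𝓞 ℚ)), ((primesEquiv v : Nat.Primes) : ℕ) ≠ p →
        W.HasGoodReductionAt v → ∀ 𝔓 ∈ v.primesAbove,
        resLe (W.torsionGaloisModule ((p : ℤ) ^ k)).toTopRep
          (inf_le_left : κ.layerSubgroup n ⊓ 𝔓.inertia (absoluteGaloisGroup ℚ) ≤ κ.layerSubgroup n) 1
          (reduceH1Pk W p k (κ.layerSubgroup n) y) = 0) →
      (p : ℤ_[p]) ^ e • y ∈ integralH1 (tateRep W p) p (κ.layerSubgroup n) := by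
  obtain ⟨e, h⟩ := exists_pow_smul_mem_integralH1_layerSubgroup_of_forall_reduceH1Pk W p κ
  refine ⟨e, fun n y hy ↦ h n y fun k v hv hnadd 𝔓 h𝔓 ↦ hy k v hv ?_ 𝔓 h𝔓⟩
  by_contra hgood
  exact hnadd (hasAdditiveReductionAt_of_hasCM_of_not_hasGoodReductionAt W hCM hgood)

end Rat

end SignedLowerOffTwo.PTDeep

end Summit.BirchSwinnertonDyer.BirchSwinnertonDyer.Theorems

end
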